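import Summits.CriticalPhenomena.PercolationContinuityZ3.Theorems.FK.BoxErgodicAveragesFK
import Summits.CriticalPhenomena.PercolationContinuityZ3.Theorems.FK.ClusterCountBoundaryCorrection
import Mathlib.MeasureTheory.Integral.DominatedConvergence
import HarnessLib

/-!
# FK-continuity cell, FO-10a: GRIMMETT'S (4.83) FOR THE FREE BOX CLUSTER COUNT — `k(ω,Λ_n)/|Λ_n| → κ^b(p,q) = φ^b_{p,q}(|C_0|⁻¹)`
# `φ^b_{p,q}`-ALMOST SURELY and in `L¹(φ^b_{p,q})`, as `Λ_n = [-n,n]^d ↑ ℤ^d`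

Registered R113 (cell INBOX l.7611, 2026-08-25); registry row FO-10a-g342e; label ERG-B (coordinator fk-4 g228).
Cell `fk-continuity` (bschramm), row FO-10a (pressure layer); support file for the FK-continuity transplant
(`--supports stmt-CriticalPhenomena-4575`); builds on p205010 (kernel theorem, internal audit signed; external expert
review pending). Pure proofs; no definitions, no named facts, no sorries; every `d ≥ 1`, `0 ≤ p ≤ 1`, `q ≥ 1`, both
boundary conditions `b`. UNCONDITIONAL infinite-volume structure; it decides nothing about FH / TP_FK / the value of `κ^b`
at any `(p,q)`.

Grimmett 2006, p. 94, read here with `k(ω,Λ)` the number of open clusters of `(Λ, ω ∩ E_Λ)` (the free box count;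
Grimmett's own `k(ω,Λ)` of (4.12)/p. 94 counts the clusters of `ω` that intersect `Λ`, `Σ_{x∈Λ} |C_x(ω) ∩ Λ|⁻¹` — the two
differ by at most `|∂Λ|` and (4.83) holds for both; the literal version is `ClustersMeetingBoxErgodic.lean`):
`Σ_{x∈Λ} |C_x|⁻¹ ≤ k(ω,Λ) ≤ Σ_{x∈Λ} |C_x|⁻¹ + |∂Λ|` and, "by the ergodic theorem applied to the family `{|C_x|⁻¹ : x ∈ ℤ^d}`",
(4.83) `k(ω,Λ)/|Λ| → φ^b_{p,q}(|C_0|⁻¹)` `φ^b_{p,q}`-a.s. and in `L¹(φ^b_{p,q})` as `Λ ↑ ℤ^d`. The two deterministic inequalities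
are `ClusterCountBoundaryCorrection.lean` (with `k(ω,Λ) = Σ_{x∈Λ} |C_x(ω ∩ E_Λ)|⁻¹`, `sum_inv_ncard_openCluster_liftEdges`); the
ergodic theorem for `{|C_x|⁻¹}` is `BoxErgodicAveragesFK.ae_tendsto_boxAverage_inv_ncard_rcLimit`. Hence:

* **`ae_tendsto_clusterCount_div_card_box`** — (4.83), ALMOST-SURE clause:
  `|Λ_n|⁻¹ Σ_{x∈Λ_n} |C_x(ω ∩ E_{Λ_n})|⁻¹ → κ^b(p,q)` for `φ^b_{p,q}`-a.e. `ω`;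
* **`tendsto_integral_abs_clusterCount_div_card_box_sub`** — (4.83), `L¹` clause (dominated convergence, `0 ≤ k(ω,Λ)/|Λ| ≤ 1`):
  `∫ | |Λ_n|⁻¹ k(ω,Λ_n) − κ^b(p,q) | dφ^b_{p,q} → 0` (also obtained from mixing alone in `ClusterCountLLN.lean`).

## References

* G. Grimmett, *The Random-Cluster Model*, Springer 2006 (`book:grimmett2006-random-cluster-model`): §4.5, proof of
  Lemma (4.79), displays after (4.82), and (4.83) [PDF p. 94]; Cor. (4.23) [PDF p. 79]. [Grimmett2006]
-/

noncomputable section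

open MeasureTheory Set Filter Finset
open scoped Topology ENNReal

namespace Summit.CriticalPhenomena.PercolationContinuityZ3.Theorems.FK

open Literature.Probability.Percolation Literature.Probability.LatticeModels

variable {d : ℕ} {p q : ℝ}

/-- The normalised box cluster count lies in `[0, 1]`: `0 ≤ |Λ|⁻¹ Σ_{x∈Λ} |C_x(ω ∩ E_Λ)|⁻¹ ≤ 1`. [folklore] -/
theorem avg_inv_ncard_inter_mem_Icc (ω : BondConfig (Site d)) (Λ : Finset (Site d)) :
    (#Λ : ℝ)⁻¹ * ∑ x ∈ Λ, (((openCluster (ω ∩ ↑(edgesIn (zdGraph d) Λ)) x).ncard : ℝ))⁻¹ ∈ Set.Icc (0 : ℝ) 1 := by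
  have hs0 : 0 ≤ ∑ x ∈ Λ, (((openCluster (ω ∩ ↑(edgesIn (zdGraph d) Λ)) x).ncard : ℝ))⁻¹ :=
    Finset.sum_nonneg fun x _ => inv_nonneg.2 (Nat.cast_nonneg _)
  have hs1 : ∑ x ∈ Λ, (((openCluster (ω ∩ ↑(edgesIn (zdGraph d) Λ)) x).ncard : ℝ))⁻¹ ≤ #Λ := by
    calc ∑ x ∈ Λ, (((openCluster (ω ∩ ↑(edgesIn (zdGraph d) Λ)) x).ncard : ℝ))⁻¹ ≤ ∑ x ∈ Λ, (1 : ℝ) :=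
          Finset.sum_le_sum fun x _ => Nat.cast_inv_le_one _
      _ = #Λ := by rw [Finset.sum_const, nsmul_eq_mul, mul_one]
  refine ⟨mul_nonneg (inv_nonneg.2 (Nat.cast_nonneg _)) hs0, ?_⟩
  rcases Nat.eq_zero_or_pos #Λ with h0 | hpos
  · rw [h0, Nat.cast_zero, inv_zero, zero_mul]; exact zero_le_one
  · have hc : (0 : ℝ) < #Λ := by exact_mod_cast hpos
    rw [inv_mul_le_iff₀ hc, mul_one]; exact hs1

/-- **GRIMMETT 2006, (4.83) — THE ALMOST-SURE CLAUSE**: for `d ≥ 1`, `0 ≤ p ≤ 1`, `q ≥ 1`, `b ∈ {0,1}`: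
`|Λ_n|⁻¹ k(ω,Λ_n) → κ^b(p,q) = ∫ |C_0|⁻¹ dφ^b_{p,q}` for `φ^b_{p,q}`-a.e. `ω`, where `k(ω,Λ) = Σ_{x∈Λ} |C_x(ω ∩ E_Λ)|⁻¹` is
the number of open clusters of `(Λ, ω ∩ E_Λ)` (ergodic theorem for `{|C_x|⁻¹}` + the boundary correction `≤ |∂Λ_n|/|Λ_n| → 0`).
[cite: Grimmett2006, §4.5 (4.83)] -/
theorem ae_tendsto_clusterCount_div_card_box (hd : 1 ≤ d) (b : Bool) (hp : p ∈ Set.Icc (0 : ℝ) 1) (hq : 1 ≤ q) :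
    ∀ᵐ ω ∂(rcLimit d b p q), Tendsto (fun N : ℕ => ((#(box d N) : ℝ))⁻¹ *
      ∑ x ∈ box d N, (((openCluster (ω ∩ ↑(edgesIn (zdGraph d) (box d N))) x).ncard : ℝ))⁻¹) atTop
        (𝓝 (∫ ω', ((openCluster ω' (0 : Site d)).ncard : ℝ)⁻¹ ∂(rcLimit d b p q))) := by
  have hlat := (isBoxLimit_rcLimit b hp hq (d := d)).ae_subset_edgeSet hp (one_pos.trans_le hq)
  filter_upwards [ae_tendsto_boxAverage_inv_ncard_rcLimit hd b hp hq, hlat] with ω hω hωlat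
  set κ := ∫ ω', ((openCluster ω' (0 : Site d)).ncard : ℝ)⁻¹ ∂(rcLimit d b p q) with hκ
  -- upper comparison sequence: the free average plus `|∂Λ_N|/|Λ_N|`
  have hup : Tendsto (fun N : ℕ => ((#(box d N) : ℝ))⁻¹ * ∑ x ∈ box d N, ((openCluster ω x).ncard : ℝ)⁻¹ +
      (#(innerBoundary (zdGraph d) (box d N)) : ℝ) / #(box d N)) atTop (𝓝 κ) := by
    have h := hω.add (tendsto_card_innerBoundary_box_div_card_box (d := d))
    rwa [add_zero] at h
  refine tendsto_of_tendsto_of_tendsto_of_le_of_le hω hup (fun N => ?_) (fun N => ?_)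
  · exact mul_le_mul_of_nonneg_left (sum_inv_ncard_le_sum_inv_ncard_inter ω (box d N)) (inv_nonneg.2 (Nat.cast_nonneg _))
  · have hpos : (0 : ℝ) < #(box d N) := by exact_mod_cast Finset.card_pos.2 (box_nonempty d N)
    have h2 := sum_inv_ncard_inter_sub_sum_inv_ncard_le_card_innerBoundary hωlat (box d N)
    rw [div_eq_inv_mul, ← mul_add]
    exact mul_le_mul_of_nonneg_left (by linarith) (inv_nonneg.2 hpos.le)

/-- **GRIMMETT 2006, (4.83) — THE `L¹` CLAUSE**: `∫ | |Λ_n|⁻¹ k(ω,Λ_n) − κ^b(p,q) | dφ^b_{p,q} → 0` (`d ≥ 1`; dominated convergence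
from the almost-sure clause, the normalised cluster count lying in `[0,1]`). [cite: Grimmett2006, §4.5 (4.83)] -/
theorem tendsto_integral_abs_clusterCount_div_card_box_sub (hd : 1 ≤ d) (b : Bool) (hp : p ∈ Set.Icc (0 : ℝ) 1)
    (hq : 1 ≤ q) :
    Tendsto (fun N : ℕ => ∫ ω, |((#(box d N) : ℝ))⁻¹ *
        ∑ x ∈ box d N, (((openCluster (ω ∩ ↑(edgesIn (zdGraph d) (box d N))) x).ncard : ℝ))⁻¹ -
        ∫ ω', ((openCluster ω' (0 : Site d)).ncard : ℝ)⁻¹ ∂(rcLimit d b p q)| ∂(rcLimit d b p q)) atTop (𝓝 0) := by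
  haveI := isProbabilityMeasure_rcLimit (d := d) b p q
  set P := rcLimit d b p q with hP
  set κ := ∫ ω', ((openCluster ω' (0 : Site d)).ncard : ℝ)⁻¹ ∂P with hκ
  have hκ0 : 0 ≤ κ := integral_nonneg fun ω => inv_nonneg.2 (Nat.cast_nonneg _)
  have hκ1 : κ ≤ 1 := by
    calc κ ≤ ∫ _, (1 : ℝ) ∂P := integral_mono (integrable_inv_ncard_openCluster' (0 : Site d) P) (integrable_const _)
          fun ω => Nat.cast_inv_le_one _
      _ = 1 := by rw [integral_const, smul_eq_mul, probReal_univ, one_mul]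
  have hmeas : ∀ N : ℕ, AEStronglyMeasurable (fun ω : BondConfig (Site d) => |((#(box d N) : ℝ))⁻¹ *
      ∑ x ∈ box d N, (((openCluster (ω ∩ ↑(edgesIn (zdGraph d) (box d N))) x).ncard : ℝ))⁻¹ - κ|) P := fun N =>
    ((((integrable_finsetSum _ fun x _ => integrable_inv_ncard_openCluster_inter x _ P).const_mul _).sub
      (integrable_const κ)).abs).aestronglyMeasurable
  have hlim := tendsto_integral_of_dominated_convergence (F := fun (N : ℕ) (ω : BondConfig (Site d)) =>
      |((#(box d N) : ℝ))⁻¹ * ∑ x ∈ box d N, (((openCluster (ω ∩ ↑(edgesIn (zdGraph d) (box d N))) x).ncard : ℝ))⁻¹ - κ|)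
    (f := fun _ => (0 : ℝ)) (fun _ => (2 : ℝ)) hmeas (integrable_const _)
    (fun N => Eventually.of_forall fun ω => ?_) ?_
  · simpa only [integral_zero] using hlim
  · -- the bound `| |avg − κ| | ≤ 2`
    rw [Real.norm_eq_abs, abs_abs]
    have h := avg_inv_ncard_inter_mem_Icc ω (box d N)
    rw [abs_le]; constructor <;> linarith [h.1, h.2]
  · filter_upwards [ae_tendsto_clusterCount_div_card_box hd b hp hq] with ω hω
    have h := (hω.sub_const κ).abs
    rwa [sub_self, abs_zero] at h

end Summit.CriticalPhenomena.PercolationContinuityZ3.Theorems.FK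

end
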